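import Mathlib.LinearAlgebra.Eigenspace.Pi
import Mathlib.LinearAlgebra.Eigenspace.Triangularizable
import Mathlib.LinearAlgebra.Trace
import Mathlib.Algebra.DirectSum.LinearMap
import Mathlib.Data.Nat.Factorization.Basic
import Mathlib.Analysis.Complex.Polynomial.Basic
import HarnessLib

/-!
# Multiplicities in semisimple Hecke modules are determined by traces
# (the linear algebra of Pizer 1980, proof of Thm. 2.28: "two representations of a semisimple
# ring are equivalent if and only if their traces are equal")

Topic `NumberTheory/Automorphic`; pure linear algebra, theorems and definitions with bodies only
(no named fact).  This is the abstract engine of Eichler's basis theorem in A. Pizer's Hecke-module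
form (*An algorithm for computing modular forms on `Γ₀(N)`*, J. Algebra 64 (1980), Thm. 2.28 from
the trace identity Thm. 2.25 (2.8)): *"Our main tool now will be the fact that two representations
of a semisimple ring are equivalent if and only if their traces are equal (see [25, Theorem 3,
p. 458]) … By Proposition 2.22 the `B(n)` with `(n, N) = 1` generate a commutative semisimple
ring"* (loc. cit. p. 359).  We formalise exactly what that argument needs, for families of
operators indexed like Hecke operators.

* `IsHeckeFamily N c T` — a **Hecke family away from `N`** on a `ℂ`-module `V`: operators
  `T n ∈ End V` (`n : ℕ`) with `T 1 = 1`, `T (m n) = T m ∘ T n` for coprime `m, n` with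
  `(mn, N) = 1`, and the prime-power recursion `T(q^{a+2}) = T(q) T(q^{a+1}) - c(q) T(q^a)` for
  primes `q ∤ N` (for Brandt matrices and for `T_n` on `S₂(Γ₀(N))`, `c(q) = q`; Pizer Prop. 2.22,
  Eichler 1973 II §6 Thm. 2; Diamond–Shurman §5.3).
* `IsHeckeFamily.mul_mem_span`, `IsHeckeFamily.listProd_mem_span` — the `ℂ`-span of
  `{T n : n ≥ 1, (n, N) = 1}` is stable under left multiplication by `T q` (`q ∤ N` prime), hence
  contains every product `∏ᵢ (T qᵢ - aᵢ)`: *the `T(n)`, `(n, N) = 1`, span the algebra they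
  generate*.
* `IsHeckeFamily.prod` and `trace_listProd_eq_of_trace_eq` — for two Hecke families `T_A`, `T_B`
  (same `N`, `c`) with `tr T_A(n) = tr T_B(n)` for all `n ≥ 1` prime to `N`, every such product has
  the same trace on `A` and on `B` (apply the span lemma to the product family on `A × B`).
* `eigenChar T χ = ⋂_q ker (T q - χ q)` (`q` over the primes `∤ N`), the simultaneous eigenspace of
  the character `χ`; for a commuting family of diagonalisable `T q` on a finite-dimensional space
  these are independent and span (Mathlib's simultaneous generalised eigenspaces,
  `Module.End.iSup_iInf_maxGenEigenspace_eq_top_of_iSup_maxGenEigenspace_eq_top_of_commute`), only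
  finitely many are non-zero, and the trace of an operator acting on `eigenChar T χ` by the scalar
  `e χ` is `Σ_χ e(χ) dim eigenChar T χ` (`trace_eq_sum_finrank_eigenChar_mul`).
* `finrank_eigenChar_eq_of_trace_eq` — **equal traces ⇒ equal multiplicities**: under these
  hypotheses `dim eigenChar T_A χ = dim eigenChar T_B χ` for every character `χ` (kill all other
  characters occurring in `A` or `B` by a product `∏ (T q_ψ - ψ(q_ψ))`, `ψ(q_ψ) ≠ χ(q_ψ)`, whose
  trace is a non-zero multiple of the multiplicity of `χ`).
* `nonempty_linearEquiv_of_finrank_eigenChar_eq` — **equal multiplicities ⇒ isomorphic Hecke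
  modules**: a `ℂ`-linear isomorphism `A ≃ B` intertwining `T_A q` and `T_B q` for all primes
  `q ∤ N`.

## References

* [Pizer1980] A. Pizer, J. Algebra 64 (1980) 340–390, Prop. 2.22, Thm. 2.25, Remark 2.27,
  Thm. 2.28 and its proof (p. 360).
* [Eichler1973] M. Eichler, LNM 320 (1973), Ch. II §6 Thm. 2, Ch. IV §1.
* [DiamondShurman2005] F. Diamond, J. Shurman, GTM 228, §5.3 (`T_{p^r}`, `T_n`).
-/

noncomputable section

open Module Module.End

namespace Literature.NumberTheory.Automorphic

/-! ### Hecke families -/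

section HeckeFamily

variable {V : Type*} [AddCommGroup V] [Module ℂ V]

/-- A **Hecke family away from `N`** with prime-power constants `c`: operators `T n` (`n : ℕ`) on
`V` with `T 1 = 1`, `T (m n) = T m ∘ T n` for coprime `m, n` with `(mn, N) = 1`, and
`T (q^{a+2}) = T q ∘ T (q^{a+1}) - c q • T (q^a)` for every prime `q ∤ N` and `a ≥ 0`
(Eichler 1973, II §6 Thm. 2 (18)–(19) for Brandt matrices with `c q = q`; Diamond–Shurman §5.3
for `T_n` on `S_k(Γ₀(N))` with `c q = q^{k-1}`). Values at `n` not prime to `N` are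
unconstrained. [cite: Pizer1980, Prop. 2.22] -/
structure IsHeckeFamily (N : ℕ) (c : ℕ → ℂ) (T : ℕ → Module.End ℂ V) : Prop where
  /-- `T 1 = 1`. -/
  map_one : T 1 = 1
  /-- `T (m n) = T m ∘ T n` for coprime `m, n` with `mn` prime to `N`. -/
  map_mul_of_coprime : ∀ {m n : ℕ}, m.Coprime n → (m * n).Coprime N → T (m * n) = T m * T n
  /-- `T (q^{a+2}) = T q ∘ T (q^{a+1}) - c q • T (q^a)` for primes `q ∤ N`. -/
  map_prime_pow : ∀ {q : ℕ}, q.Prime → ¬ q ∣ N → ∀ a : ℕ,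
    T (q ^ (a + 2)) = T q * T (q ^ (a + 1)) - c q • T (q ^ a)

namespace IsHeckeFamily

variable {N : ℕ} {c : ℕ → ℂ} {T : ℕ → Module.End ℂ V}

/-- The `ℂ`-span of the Hecke family away from `N`: `span {T n : n ≥ 1, (n, N) = 1}`. [folklore] -/
def span (_h : IsHeckeFamily N c T) : Submodule ℂ (Module.End ℂ V) :=
  Submodule.span ℂ (T '' {n : ℕ | 0 < n ∧ n.Coprime N})

/-- The generators `T n`, `n ≥ 1` prime to `N`, lie in the span. [folklore] -/
theorem mem_span_of (h : IsHeckeFamily N c T) {n : ℕ} (hn : 0 < n) (hnN : n.Coprime N) :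
    T n ∈ h.span :=
  Submodule.subset_span ⟨n, ⟨hn, hnN⟩, rfl⟩

/-- `1 = T 1` lies in the span. [folklore] -/
theorem one_mem_span (h : IsHeckeFamily N c T) : (1 : Module.End ℂ V) ∈ h.span := by
  rw [← h.map_one]
  exact h.mem_span_of one_pos (Nat.coprime_one_left N)

/-- `T q ∘ T (q^a) = T (q^{a+1}) + [a ≥ 1] c q • T (q^{a-1})`, the recursion read as a product
formula. [folklore] -/
theorem mul_prime_pow (h : IsHeckeFamily N c T) {q : ℕ} (hq : q.Prime) (hqN : ¬ q ∣ N) (a : ℕ) :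
    T q * T (q ^ (a + 1)) = T (q ^ (a + 2)) + c q • T (q ^ a) := by
  rw [h.map_prime_pow hq hqN a, sub_add_cancel]

/-- **The span of a Hecke family is stable under `T q`** (`q ∤ N` prime): for `n = q^a m`,
`q ∤ m`, `T q T n = T(q^{a+1} m) + [a ≥ 1] c(q) T(q^{a-1} m)`. [cite: Pizer1980, Prop. 2.22] -/
theorem mul_mem_span (h : IsHeckeFamily N c T) {q : ℕ} (hq : q.Prime) (hqN : ¬ q ∣ N)
    {x : Module.End ℂ V} (hx : x ∈ h.span) : T q * x ∈ h.span := by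
  induction hx using Submodule.span_induction with
  | mem x hx =>
    obtain ⟨n, ⟨hn, hnN⟩, rfl⟩ := hx
    obtain ⟨a, m, hqm, rfl⟩ := Nat.exists_eq_pow_mul_and_not_dvd hn.ne' q hq.one_lt.ne'
    have hm0 : 0 < m := Nat.pos_of_ne_zero fun h0 => by simp [h0] at hn
    have hmN : m.Coprime N := Nat.Coprime.coprime_mul_left hnN
    have hqN' : q.Coprime N := (Nat.Prime.coprime_iff_not_dvd hq).mpr hqN
    have hcop : ∀ b : ℕ, (q ^ b).Coprime m := fun b =>
      Nat.Coprime.pow_left _ ((Nat.Prime.coprime_iff_not_dvd hq).mpr hqm)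
    have hcopN : ∀ b : ℕ, (q ^ b * m).Coprime N := fun b =>
      Nat.Coprime.mul_left (Nat.Coprime.pow_left _ hqN') hmN
    rw [h.map_mul_of_coprime (hcop a) (hcopN a), ← mul_assoc]
    cases a with
    | zero =>
      rw [pow_zero, h.map_one, mul_one, ← pow_one q, ← h.map_mul_of_coprime (hcop 1) (hcopN 1)]
      exact h.mem_span_of (Nat.mul_pos (pow_pos hq.pos _) hm0) (hcopN 1)
    | succ a =>
      rw [h.mul_prime_pow hq hqN a, add_mul, smul_mul_assoc,
        ← h.map_mul_of_coprime (hcop (a + 2)) (hcopN (a + 2)),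
        ← h.map_mul_of_coprime (hcop a) (hcopN a)]
      exact Submodule.add_mem _ (h.mem_span_of (Nat.mul_pos (pow_pos hq.pos _) hm0) (hcopN _))
        (Submodule.smul_mem _ _ (h.mem_span_of (Nat.mul_pos (pow_pos hq.pos _) hm0) (hcopN _)))
  | zero => rw [mul_zero]; exact Submodule.zero_mem _
  | add x y _ _ hx hy => rw [mul_add]; exact Submodule.add_mem _ hx hy
  | smul a x _ hx => rw [mul_smul_comm]; exact Submodule.smul_mem _ _ hx

/-- The product `∏_{(q, a) ∈ L} (T q - a)` attached to a list of (prime, scalar) pairs. [folklore] -/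
def listProd (T : ℕ → Module.End ℂ V) (L : List (ℕ × ℂ)) : Module.End ℂ V :=
  (L.map fun qa => T qa.1 - qa.2 • (1 : Module.End ℂ V)).prod

/-- The empty product is `1`. [folklore] -/
@[simp] theorem listProd_nil : listProd T [] = 1 := by simp [listProd]

/-- `listProd` of a cons. [folklore] -/
@[simp] theorem listProd_cons (qa : ℕ × ℂ) (L : List (ℕ × ℂ)) :
    listProd T (qa :: L) = (T qa.1 - qa.2 • 1) * listProd T L := by
  simp [listProd]

/-- **Products `∏ (T qᵢ - aᵢ)` (`qᵢ ∤ N` primes) lie in the span of the `T n`, `(n, N) = 1`.**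
[cite: Pizer1980, Prop. 2.22] -/
theorem listProd_mem_span (h : IsHeckeFamily N c T) {L : List (ℕ × ℂ)}
    (hL : ∀ qa ∈ L, qa.1.Prime ∧ ¬ qa.1 ∣ N) : listProd T L ∈ h.span := by
  induction L with
  | nil => rw [listProd_nil]; exact h.one_mem_span
  | cons qa L ih =>
    rw [listProd_cons, sub_mul, smul_mul_assoc, one_mul]
    have hqa := hL qa (by simp)
    have ih' := ih fun x hx => hL x (by simp [hx])
    exact Submodule.sub_mem _ (h.mul_mem_span hqa.1 hqa.2 ih') (Submodule.smul_mem _ _ ih')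

end IsHeckeFamily

end HeckeFamily

/-! ### Product families and equality of traces -/

section Prod

variable {A B : Type*} [AddCommGroup A] [Module ℂ A] [AddCommGroup B] [Module ℂ B]
variable {N : ℕ} {c : ℕ → ℂ} {TA : ℕ → Module.End ℂ A} {TB : ℕ → Module.End ℂ B}

/-- `prodMap` is compatible with subtraction (componentwise). [folklore] -/
theorem prodMap_sub (f₁ f₂ : Module.End ℂ A) (g₁ g₂ : Module.End ℂ B) :
    (f₁ - f₂).prodMap (g₁ - g₂) = f₁.prodMap g₁ - f₂.prodMap g₂ := rfl

/-- The product of two Hecke families (same `N`, `c`) is a Hecke family on `A × B`. [folklore] -/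
theorem IsHeckeFamily.prod (hA : IsHeckeFamily N c TA) (hB : IsHeckeFamily N c TB) :
    IsHeckeFamily N c (fun n => (TA n).prodMap (TB n)) where
  map_one := by simp only [hA.map_one, hB.map_one, LinearMap.prodMap_one]
  map_mul_of_coprime hmn hN := by
    simp only [hA.map_mul_of_coprime hmn hN, hB.map_mul_of_coprime hmn hN, LinearMap.prodMap_mul]
  map_prime_pow {q} hq hqN a := by
    change (TA (q ^ (a + 2))).prodMap (TB (q ^ (a + 2))) =
      (TA q).prodMap (TB q) * (TA (q ^ (a + 1))).prodMap (TB (q ^ (a + 1))) -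
        c q • (TA (q ^ a)).prodMap (TB (q ^ a))
    rw [LinearMap.prodMap_mul, ← LinearMap.prodMap_smul, ← prodMap_sub, ← hA.map_prime_pow hq hqN a,
      ← hB.map_prime_pow hq hqN a]

/-- `listProd` of a product family is the product of the two `listProd`s. [folklore] -/
theorem listProd_prodMap (L : List (ℕ × ℂ)) :
    IsHeckeFamily.listProd (fun n => (TA n).prodMap (TB n)) L =
      (IsHeckeFamily.listProd TA L).prodMap (IsHeckeFamily.listProd TB L) := by
  induction L with
  | nil => simp
  | cons qa L ih =>
    rw [IsHeckeFamily.listProd_cons, IsHeckeFamily.listProd_cons, IsHeckeFamily.listProd_cons, ih,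
      ← LinearMap.prodMap_one, ← LinearMap.prodMap_smul, ← prodMap_sub, LinearMap.prodMap_mul]

/-- **Equal traces of the Hecke family give equal traces of every product `∏ (T qᵢ - aᵢ)`**
(`qᵢ ∤ N` primes): the two projections of the span identity on `A × B`. [cite: Pizer1980, Thm. 2.28 (proof)] -/
theorem trace_listProd_eq_of_trace_eq (hA : IsHeckeFamily N c TA) (hB : IsHeckeFamily N c TB)
    (htr : ∀ n : ℕ, 0 < n → n.Coprime N →
      LinearMap.trace ℂ A (TA n) = LinearMap.trace ℂ B (TB n))
    {L : List (ℕ × ℂ)} (hL : ∀ qa ∈ L, qa.1.Prime ∧ ¬ qa.1 ∣ N) :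
    LinearMap.trace ℂ A (IsHeckeFamily.listProd TA L) =
      LinearMap.trace ℂ B (IsHeckeFamily.listProd TB L) := by
  -- the property "the two diagonal blocks have equal traces" holds on the span of the product family
  have key : ∀ x ∈ (hA.prod hB).span,
      LinearMap.trace ℂ A ((LinearMap.fst ℂ A B).comp (x.comp (LinearMap.inl ℂ A B))) =
        LinearMap.trace ℂ B ((LinearMap.snd ℂ A B).comp (x.comp (LinearMap.inr ℂ A B))) := by
    intro x hx
    induction hx using Submodule.span_induction with
    | mem x hx =>
      obtain ⟨n, ⟨hn, hnN⟩, rfl⟩ := hx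
      have h1 : (LinearMap.fst ℂ A B).comp (((TA n).prodMap (TB n)).comp (LinearMap.inl ℂ A B)) =
          TA n := by ext; simp
      have h2 : (LinearMap.snd ℂ A B).comp (((TA n).prodMap (TB n)).comp (LinearMap.inr ℂ A B)) =
          TB n := by ext; simp
      rw [h1, h2]
      exact htr n hn hnN
    | zero => simp
    | add x y _ _ hx hy =>
      simp only [LinearMap.add_comp, LinearMap.comp_add, map_add, hx, hy]
    | smul a x _ hx =>
      simp only [LinearMap.smul_comp, LinearMap.comp_smul, map_smul, hx]
  have hmem := (hA.prod hB).listProd_mem_span hL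
  rw [listProd_prodMap] at hmem
  have h := key _ hmem
  have h1 : (LinearMap.fst ℂ A B).comp (((IsHeckeFamily.listProd TA L).prodMap
      (IsHeckeFamily.listProd TB L)).comp (LinearMap.inl ℂ A B)) = IsHeckeFamily.listProd TA L := by
    ext; simp
  have h2 : (LinearMap.snd ℂ A B).comp (((IsHeckeFamily.listProd TA L).prodMap
      (IsHeckeFamily.listProd TB L)).comp (LinearMap.inr ℂ A B)) = IsHeckeFamily.listProd TB L := by
    ext; simp
  rwa [h1, h2] at h

end Prod

/-! ### Simultaneous eigenspaces of a commuting diagonalisable family -/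

section Eigen

variable {V : Type*} [AddCommGroup V] [Module ℂ V]

/-- The primes not dividing `N`: the index set of the Hecke operators "away from `N`". [folklore] -/
abbrev PrimesNotDvd (N : ℕ) : Type := {q : ℕ // q.Prime ∧ ¬ q ∣ N}

/-- The **simultaneous eigenspace** `V_χ = ⋂_{q ∤ N prime} ker (T q - χ q)` of the family `T` for a
character `χ` of the primes away from `N` (an eigenvalue system). [folklore] -/
def eigenChar (N : ℕ) (T : ℕ → Module.End ℂ V) (χ : PrimesNotDvd N → ℂ) : Submodule ℂ V :=
  ⨅ q : PrimesNotDvd N, (T q).eigenspace (χ q)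

variable {N : ℕ} {T : ℕ → Module.End ℂ V}

/-- Membership in a simultaneous eigenspace: `T q v = χ(q) v` for all primes `q ∤ N`. [folklore] -/
theorem mem_eigenChar_iff {χ : PrimesNotDvd N → ℂ} {v : V} :
    v ∈ eigenChar N T χ ↔ ∀ q : PrimesNotDvd N, T q v = χ q • v := by
  simp only [eigenChar, Submodule.mem_iInf, Module.End.mem_eigenspace_iff]

/-- A **semisimple commuting family** away from `N`: the `T q` (`q ∤ N` prime) pairwise commute and
`V` is spanned by their simultaneous eigenspaces (e.g. each `T q` diagonalisable on a
finite-dimensional `V`, `IsSemisimpleFamily.of_maxGenEigenspace_eq`). For Brandt matrices this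
is Pizer 1980 Prop. 2.22 / Eichler's weight symmetry; for `T_p` on `S_k(Γ₀(N))` it is Petersson
self-adjointness. [cite: Pizer1980, Prop. 2.22] -/
structure IsSemisimpleFamily (N : ℕ) (T : ℕ → Module.End ℂ V) : Prop where
  /-- The operators at primes away from `N` commute. -/
  comm : ∀ q q' : PrimesNotDvd N, Commute (T q) (T q')
  /-- The simultaneous eigenspaces span `V`. -/
  iSup_eq_top : ⨆ χ, eigenChar N T χ = ⊤

/-- **Diagonalisable + commuting ⇒ semisimple family**: in finite dimension, if the `T q`
(`q ∤ N` prime) commute and the generalised eigenspaces of each `T q` are eigenspaces, the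
simultaneous eigenspaces span (Mathlib's simultaneous triangularisation of commuting families).
[folklore] -/
theorem IsSemisimpleFamily.of_maxGenEigenspace_eq [FiniteDimensional ℂ V]
    (hcomm : ∀ q q' : PrimesNotDvd N, Commute (T q) (T q'))
    (hdiag : ∀ (q : PrimesNotDvd N) (μ : ℂ), (T q).maxGenEigenspace μ = (T q).eigenspace μ) :
    IsSemisimpleFamily N T where
  comm := hcomm
  iSup_eq_top := by
    have key := Module.End.iSup_iInf_maxGenEigenspace_eq_top_of_iSup_maxGenEigenspace_eq_top_of_commute
      (fun q : PrimesNotDvd N => T q) (fun q q' _ => hcomm q q')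
      (fun q => Module.End.iSup_maxGenEigenspace_eq_top _)
    simp only [hdiag] at key
    exact key

namespace IsSemisimpleFamily

/-- The simultaneous eigenspaces of a commuting family are independent. [folklore] -/
theorem iSupIndep_eigenChar (h : IsSemisimpleFamily N T) : iSupIndep (eigenChar N T) := by
  have key := Module.End.independent_iInf_maxGenEigenspace_of_forall_mapsTo
    (fun q : PrimesNotDvd N => T q)
    (fun q q' φ => Module.End.mapsTo_maxGenEigenspace_of_comm (h.comm q' q) φ)
  exact key.mono fun χ => iInf_mono fun q => Module.End.eigenspace_le_maxGenEigenspace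

/-- The simultaneous eigenspaces of a semisimple commuting family span (field accessor). [folklore] -/
theorem iSup_eigenChar_eq_top (h : IsSemisimpleFamily N T) : ⨆ χ, eigenChar N T χ = ⊤ :=
  h.iSup_eq_top

/-- `V = ⊕_χ V_χ` is an internal direct sum. [folklore] -/
theorem isInternal_eigenChar [DecidableEq (PrimesNotDvd N → ℂ)] (h : IsSemisimpleFamily N T) :
    DirectSum.IsInternal (eigenChar N T) :=
  DirectSum.isInternal_submodule_of_iSupIndep_of_iSup_eq_top h.iSupIndep_eigenChar
    h.iSup_eigenChar_eq_top

variable [FiniteDimensional ℂ V]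

/-- Only finitely many characters occur. [folklore] -/
theorem finite_ne_bot (h : IsSemisimpleFamily N T) : {χ | eigenChar N T χ ≠ ⊥}.Finite :=
  WellFoundedGT.finite_ne_bot_of_iSupIndep h.iSupIndep_eigenChar

/-- **Trace on the simultaneous eigenspace decomposition**: if `E` acts on each `V_χ` by the
scalar `e χ` then `tr E = Σ_χ e(χ) dim V_χ` (sum over the finitely many `χ` that occur).
[cite: Pizer1980, Remark 2.27] -/
theorem trace_eq_sum_finrank_eigenChar_mul (h : IsSemisimpleFamily N T) (E : Module.End ℂ V)
    (e : (PrimesNotDvd N → ℂ) → ℂ) (hE : ∀ χ, ∀ v ∈ eigenChar N T χ, E v = e χ • v) :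
    LinearMap.trace ℂ V E =
      ∑ χ ∈ h.finite_ne_bot.toFinset, (Module.finrank ℂ (eigenChar N T χ) : ℂ) * e χ := by
  classical
  have hmaps : ∀ χ, Set.MapsTo E (eigenChar N T χ) (eigenChar N T χ) := fun χ v hv => by
    have hv' : v ∈ eigenChar N T χ := hv
    show E v ∈ eigenChar N T χ
    rw [hE χ v hv']
    exact Submodule.smul_mem _ _ hv'
  rw [LinearMap.trace_eq_sum_trace_restrict' h.isInternal_eigenChar h.finite_ne_bot hmaps]
  refine Finset.sum_congr rfl fun χ _ => ?_
  have hres : E.restrict (hmaps χ) = e χ • LinearMap.id := by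
    ext ⟨v, hv⟩
    rw [LinearMap.coe_restrict_apply, LinearMap.smul_apply, LinearMap.id_apply, Submodule.coe_smul,
      hE χ v hv]
  rw [hres, map_smul, LinearMap.trace_id, smul_eq_mul, mul_comm]

end IsSemisimpleFamily

/-! ### Products of shifted Hecke operators act on `V_χ` by scalars -/

/-- Extension of a character of the primes away from `N` to all of `ℕ` by `0`. [folklore] -/
def charExt (χ : PrimesNotDvd N → ℂ) (q : ℕ) : ℂ :=
  if hq : q.Prime ∧ ¬ q ∣ N then χ ⟨q, hq⟩ else 0

/-- `charExt χ` extends `χ`. [folklore] -/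
theorem charExt_apply (χ : PrimesNotDvd N → ℂ) (q : PrimesNotDvd N) : charExt χ q = χ q := by
  rw [charExt, dif_pos q.2]

/-- On `V_χ` the product `∏_{(q,a) ∈ L} (T q - a)` (`q ∤ N` primes) is the scalar
`∏ (χ(q) - a)`. [folklore] -/
theorem listProd_apply_of_mem_eigenChar {χ : PrimesNotDvd N → ℂ} {L : List (ℕ × ℂ)}
    (hL : ∀ qa ∈ L, qa.1.Prime ∧ ¬ qa.1 ∣ N) {v : V} (hv : v ∈ eigenChar N T χ) :
    IsHeckeFamily.listProd T L v = (L.map fun qa => charExt χ qa.1 - qa.2).prod • v := by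
  induction L with
  | nil => simp
  | cons qa L ih =>
    have hqa := hL qa (by simp)
    have ih' := ih fun x hx => hL x (by simp [hx])
    have hT : T qa.1 v = charExt χ qa.1 • v := by
      rw [show charExt χ qa.1 = χ ⟨qa.1, hqa⟩ from charExt_apply χ ⟨qa.1, hqa⟩]
      exact mem_eigenChar_iff.mp hv ⟨qa.1, hqa⟩
    rw [IsHeckeFamily.listProd_cons, Module.End.mul_apply, ih', map_smul, LinearMap.sub_apply,
      LinearMap.smul_apply, Module.End.one_apply, hT, ← sub_smul, smul_smul, List.map_cons,
      List.prod_cons, mul_comm]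

/-! ### Product families, scalar families, restriction to an invariant submodule -/

section ProdFamily

variable {A B : Type*} [AddCommGroup A] [Module ℂ A] [AddCommGroup B] [Module ℂ B]
variable {TA : ℕ → Module.End ℂ A} {TB : ℕ → Module.End ℂ B}

/-- Simultaneous eigenspaces of a product family are products. [folklore] -/
theorem eigenChar_prodMap (χ : PrimesNotDvd N → ℂ) :
    eigenChar N (fun n => (TA n).prodMap (TB n)) χ = (eigenChar N TA χ).prod (eigenChar N TB χ) := by
  ext ⟨a, b⟩
  simp only [mem_eigenChar_iff, LinearMap.prodMap_apply, Prod.smul_mk, Prod.mk.injEq,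
    Submodule.mem_prod]
  exact ⟨fun h => ⟨fun q => (h q).1, fun q => (h q).2⟩, fun h q => ⟨h.1 q, h.2 q⟩⟩

/-- The product submodule `p × q` is linearly isomorphic to the product module. [folklore] -/
def _root_.Submodule.prodEquivProd (p : Submodule ℂ A) (q : Submodule ℂ B) : (p.prod q) ≃ₗ[ℂ] p × q where
  toFun x := (⟨x.1.1, x.2.1⟩, ⟨x.1.2, x.2.2⟩)
  invFun y := ⟨(y.1, y.2), ⟨y.1.2, y.2.2⟩⟩
  map_add' _ _ := rfl
  map_smul' _ _ := rfl
  left_inv _ := rfl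
  right_inv _ := rfl

/-- `dim (A × B)_χ = dim A_χ + dim B_χ`. [folklore] -/
theorem finrank_eigenChar_prodMap [FiniteDimensional ℂ A] [FiniteDimensional ℂ B]
    (χ : PrimesNotDvd N → ℂ) :
    Module.finrank ℂ (eigenChar N (fun n => (TA n).prodMap (TB n)) χ) =
      Module.finrank ℂ (eigenChar N TA χ) + Module.finrank ℂ (eigenChar N TB χ) := by
  rw [eigenChar_prodMap, ((eigenChar N TA χ).prodEquivProd (eigenChar N TB χ)).finrank_eq,
    Module.finrank_prod]

/-- The product of two semisimple commuting families is one. [folklore] -/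
theorem IsSemisimpleFamily.prod (hsA : IsSemisimpleFamily N TA) (hsB : IsSemisimpleFamily N TB) :
    IsSemisimpleFamily N (fun n => (TA n).prodMap (TB n)) where
  comm q q' := by
    change (TA q).prodMap (TB q) * (TA q').prodMap (TB q') = (TA q').prodMap (TB q') * (TA q).prodMap (TB q)
    rw [LinearMap.prodMap_mul, LinearMap.prodMap_mul, (hsA.comm q q').eq, (hsB.comm q q').eq]
  iSup_eq_top := by
    rw [Submodule.eq_top_iff']
    rintro ⟨a, b⟩
    have ha : a ∈ ⨆ χ, eigenChar N TA χ := by rw [hsA.iSup_eq_top]; trivial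
    have hb : b ∈ ⨆ χ, eigenChar N TB χ := by rw [hsB.iSup_eq_top]; trivial
    have h1 : ((a, 0) : A × B) ∈ ⨆ χ, eigenChar N (fun n => (TA n).prodMap (TB n)) χ := by
      induction ha using Submodule.iSup_induction' with
      | mem χ a ha =>
        refine Submodule.mem_iSup_of_mem χ ?_
        rw [eigenChar_prodMap]
        exact ⟨ha, Submodule.zero_mem _⟩
      | zero => exact Submodule.zero_mem _
      | add x y _ _ hx hy =>
        have : ((x + y, 0) : A × B) = (x, 0) + (y, 0) := by simp
        rw [this]
        exact Submodule.add_mem _ hx hy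
    have h2 : ((0, b) : A × B) ∈ ⨆ χ, eigenChar N (fun n => (TA n).prodMap (TB n)) χ := by
      induction hb using Submodule.iSup_induction' with
      | mem χ b hb =>
        refine Submodule.mem_iSup_of_mem χ ?_
        rw [eigenChar_prodMap]
        exact ⟨Submodule.zero_mem _, hb⟩
      | zero => exact Submodule.zero_mem _
      | add x y _ _ hx hy =>
        have : ((0, x + y) : A × B) = (0, x) + (0, y) := by simp
        rw [this]
        exact Submodule.add_mem _ hx hy
    have : ((a, b) : A × B) = (a, 0) + (0, b) := by simp
    rw [this]
    exact Submodule.add_mem _ h1 h2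

end ProdFamily

section Scalar

/-- The **scalar family** `n ↦ f n • 1` on `V` (a one-dimensional Hecke module with eigenvalue
system `f`, e.g. the Eisenstein system `σ₁`). [folklore] -/
def scalarFamily (V : Type*) [AddCommGroup V] [Module ℂ V] (f : ℕ → ℂ) (n : ℕ) :
    Module.End ℂ V :=
  f n • (1 : Module.End ℂ V)

/-- The scalar family acts by `f n`. [folklore] -/
@[simp] theorem scalarFamily_apply (f : ℕ → ℂ) (n : ℕ) (v : V) : scalarFamily V f n v = f n • v :=
  rfl

/-- A scalar family is a Hecke family as soon as `f` satisfies the Hecke relations. [folklore] -/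
theorem isHeckeFamily_scalarFamily {c : ℕ → ℂ} {f : ℕ → ℂ} (h1 : f 1 = 1)
    (hmul : ∀ {m n : ℕ}, m.Coprime n → (m * n).Coprime N → f (m * n) = f m * f n)
    (hpow : ∀ {q : ℕ}, q.Prime → ¬ q ∣ N → ∀ a : ℕ,
      f (q ^ (a + 2)) = f q * f (q ^ (a + 1)) - c q * f (q ^ a)) :
    IsHeckeFamily N c (scalarFamily V f) where
  map_one := by rw [scalarFamily, h1, one_smul]
  map_mul_of_coprime hmn hN := by
    rw [scalarFamily, scalarFamily, scalarFamily, hmul hmn hN, smul_mul_smul_comm, mul_one]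
  map_prime_pow hq hqN a := by
    rw [scalarFamily, scalarFamily, scalarFamily, scalarFamily, hpow hq hqN a, smul_mul_smul_comm,
      mul_one, smul_smul, sub_smul]

open Classical in
/-- The simultaneous eigenspaces of a scalar family: everything for the character `f`, nothing
otherwise (on a non-trivial module). [folklore] -/
theorem eigenChar_scalarFamily (f : ℕ → ℂ) (χ : PrimesNotDvd N → ℂ) :
    eigenChar N (scalarFamily V f) χ = if ∀ q : PrimesNotDvd N, χ q = f q then ⊤ else ⊥ := by
  ext v
  simp only [mem_eigenChar_iff, scalarFamily_apply]
  split_ifs with h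
  · simp only [Submodule.mem_top, iff_true]
    intro q
    rw [h q]
  · simp only [Submodule.mem_bot]
    push Not at h
    obtain ⟨q, hq⟩ := h
    constructor
    · intro hv
      have := hv q
      rw [← sub_eq_zero, ← sub_smul, smul_eq_zero, sub_eq_zero] at this
      exact this.resolve_left (Ne.symm hq)
    · intro hv q
      rw [hv, smul_zero, smul_zero]

/-- A scalar family is a semisimple commuting family. [folklore] -/
theorem isSemisimpleFamily_scalarFamily (f : ℕ → ℂ) : IsSemisimpleFamily N (scalarFamily V f) where
  comm q q' := by
    change scalarFamily V f q * scalarFamily V f q' = scalarFamily V f q' * scalarFamily V f q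
    simp only [scalarFamily, smul_mul_smul_comm, mul_comm]
  iSup_eq_top := by
    refine eq_top_iff.mpr (le_trans ?_ (le_iSup _ fun q : PrimesNotDvd N => f q))
    rw [eigenChar_scalarFamily, if_pos fun _ => rfl]

open Classical in
/-- `dim ℂ_χ = 1` if `χ = f` on the primes away from `N`, else `0`. [folklore] -/
theorem finrank_eigenChar_scalarFamily_complex (f : ℕ → ℂ) (χ : PrimesNotDvd N → ℂ) :
    Module.finrank ℂ (eigenChar N (scalarFamily ℂ f) χ) =
      if ∀ q : PrimesNotDvd N, χ q = f q then 1 else 0 := by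
  rw [eigenChar_scalarFamily]
  by_cases h : ∀ q : PrimesNotDvd N, χ q = f q
  · rw [if_pos h, if_pos h, finrank_top, Module.finrank_self]
  · rw [if_neg h, if_neg h, finrank_bot]

end Scalar

section Restrict

variable (p : Submodule ℂ V)

/-- If an invariant submodule `p` is stable under the `T q` (`q ∤ N` prime) then the simultaneous
eigenspaces of the restricted family are the `V_χ ∩ p`. [folklore] -/
theorem map_subtype_eigenChar_restrict {T' : ℕ → Module.End ℂ p}
    (hT' : ∀ (q : PrimesNotDvd N) (v : p), ((T' q v : p) : V) = T q v) (χ : PrimesNotDvd N → ℂ) :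
    (eigenChar N T' χ).map p.subtype = eigenChar N T χ ⊓ p := by
  ext v
  simp only [Submodule.mem_map, mem_eigenChar_iff, Submodule.mem_inf, Submodule.subtype_apply]
  constructor
  · rintro ⟨w, hw, rfl⟩
    refine ⟨fun q => ?_, w.2⟩
    rw [← hT' q w, hw q, Submodule.coe_smul]
  · rintro ⟨hv, hvp⟩
    refine ⟨⟨v, hvp⟩, fun q => Subtype.ext ?_, rfl⟩
    rw [hT' q, Submodule.coe_smul]
    exact hv q

/-- `dim p_χ = dim (V_χ ∩ p)` for the restricted family. [folklore] -/
theorem finrank_eigenChar_restrict {T' : ℕ → Module.End ℂ p}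
    (hT' : ∀ (q : PrimesNotDvd N) (v : p), ((T' q v : p) : V) = T q v) (χ : PrimesNotDvd N → ℂ) :
    Module.finrank ℂ (eigenChar N T' χ) = Module.finrank ℂ ↥(eigenChar N T χ ⊓ p) := by
  rw [← map_subtype_eigenChar_restrict p hT' χ, Submodule.finrank_map_subtype_eq]

/-- The simultaneous eigenspaces of the restricted family span `p` when those of `T` span `V` and
`p` is a direct summand... (elementary version used here:) if every `v ∈ p` is a sum of
simultaneous eigenvectors of `T` lying in `p`. [folklore] -/
theorem iSup_eigenChar_restrict_eq_top {T' : ℕ → Module.End ℂ p}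
    (hT' : ∀ (q : PrimesNotDvd N) (v : p), ((T' q v : p) : V) = T q v)
    (hp : ∀ v ∈ p, v ∈ ⨆ χ, eigenChar N T χ ⊓ p) : ⨆ χ, eigenChar N T' χ = ⊤ := by
  rw [Submodule.eq_top_iff']
  rintro ⟨v, hv⟩
  have key : ∀ w, w ∈ (⨆ χ, eigenChar N T χ ⊓ p) → ∀ hw : w ∈ p, (⟨w, hw⟩ : p) ∈ ⨆ χ, eigenChar N T' χ := by
    intro w hw
    induction hw using Submodule.iSup_induction' with
    | mem χ w hw =>
      intro hwp
      refine Submodule.mem_iSup_of_mem χ ?_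
      have : w ∈ (eigenChar N T' χ).map p.subtype := by
        rw [map_subtype_eigenChar_restrict p hT' χ]; exact hw
      obtain ⟨w', hw', hww⟩ := Submodule.mem_map.mp this
      have : w' = ⟨w, hwp⟩ := Subtype.ext hww
      rwa [this] at hw'
    | zero => intro _; exact Submodule.zero_mem _
    | add x y hx hy ihx ihy =>
      intro hxy
      have hxp : x ∈ p := by
        refine Submodule.iSup_induction _ (motive := fun z => z ∈ p) hx ?_ (Submodule.zero_mem _)
          (fun _ _ => Submodule.add_mem _)
        exact fun χ z hz => hz.2
      have hyp : y ∈ p := by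
        refine Submodule.iSup_induction _ (motive := fun z => z ∈ p) hy ?_ (Submodule.zero_mem _)
          (fun _ _ => Submodule.add_mem _)
        exact fun χ z hz => hz.2
      have : (⟨x + y, hxy⟩ : p) = ⟨x, hxp⟩ + ⟨y, hyp⟩ := rfl
      rw [this]
      exact Submodule.add_mem _ (ihx hxp) (ihy hyp)
  exact key v (hp v hv) hv

end Restrict

end Eigen

/-! ### Equal traces ⇒ equal multiplicities ⇒ isomorphic Hecke modules -/

section Multiplicity

variable {N : ℕ}

/-- Trace of a product `∏ (T qᵢ - aᵢ)` acting by the scalars `s φ` on the `V_φ`, when `s` kills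
every character `φ ≠ χ` that occurs: `dim V_χ · s(χ)`. [folklore] -/
theorem IsSemisimpleFamily.trace_listProd_eq_finrank_mul {W : Type*} [AddCommGroup W] [Module ℂ W]
    [FiniteDimensional ℂ W] {TW : ℕ → Module.End ℂ W} (hsW : IsSemisimpleFamily N TW)
    (χ : PrimesNotDvd N → ℂ) {L : List (ℕ × ℂ)} (hL : ∀ qa ∈ L, qa.1.Prime ∧ ¬ qa.1 ∣ N)
    (s : (PrimesNotDvd N → ℂ) → ℂ)
    (hscalar : ∀ φ, (L.map fun qa => charExt φ qa.1 - qa.2).prod = s φ)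
    (hs0 : ∀ φ, eigenChar N TW φ ≠ ⊥ → φ ≠ χ → s φ = 0) :
    LinearMap.trace ℂ W (IsHeckeFamily.listProd TW L) =
      (Module.finrank ℂ (eigenChar N TW χ) : ℂ) * s χ := by
  classical
  rw [hsW.trace_eq_sum_finrank_eigenChar_mul (IsHeckeFamily.listProd TW L) s
    (fun φ v hv => by rw [listProd_apply_of_mem_eigenChar hL hv, hscalar])]
  rw [Finset.sum_eq_single χ]
  · intro φ hφ hne
    rw [hs0 φ (hsW.finite_ne_bot.mem_toFinset.mp hφ) hne, mul_zero]
  · intro hχ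
    have : eigenChar N TW χ = ⊥ := by
      by_contra hne
      exact hχ (hsW.finite_ne_bot.mem_toFinset.mpr hne)
    rw [this, finrank_bot, Nat.cast_zero, zero_mul]

variable {A B : Type*} [AddCommGroup A] [Module ℂ A] [AddCommGroup B] [Module ℂ B]
variable [FiniteDimensional ℂ A] [FiniteDimensional ℂ B]
variable {c : ℕ → ℂ} {TA : ℕ → Module.End ℂ A} {TB : ℕ → Module.End ℂ B}

/-- **Equal traces ⇒ equal multiplicities** (Pizer 1980, proof of Thm. 2.28: "two
representations of a semisimple ring are equivalent if and only if their traces are equal",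
[25, Thm. 3]). For two semisimple commuting Hecke families away from `N` (same prime-power
constants `c`) on finite-dimensional `A`, `B` with `tr T_A(n) = tr T_B(n)` for all `n ≥ 1` prime
to `N`, every eigenvalue system `χ` has the same multiplicity in `A` and in `B`. [cite: Pizer1980, Thm. 2.28 (proof)] -/
theorem finrank_eigenChar_eq_of_trace_eq (hA : IsHeckeFamily N c TA) (hB : IsHeckeFamily N c TB)
    (hsA : IsSemisimpleFamily N TA) (hsB : IsSemisimpleFamily N TB)
    (htr : ∀ n : ℕ, 0 < n → n.Coprime N →
      LinearMap.trace ℂ A (TA n) = LinearMap.trace ℂ B (TB n))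
    (χ : PrimesNotDvd N → ℂ) :
    Module.finrank ℂ (eigenChar N TA χ) = Module.finrank ℂ (eigenChar N TB χ) := by
  classical
  -- the other characters occurring in `A` or `B`
  obtain ⟨X, hXne, hXA, hXB⟩ : ∃ X : Finset (PrimesNotDvd N → ℂ), (∀ ψ ∈ X, ψ ≠ χ) ∧
      (∀ φ, eigenChar N TA φ ≠ ⊥ → φ ≠ χ → φ ∈ X) ∧ (∀ φ, eigenChar N TB φ ≠ ⊥ → φ ≠ χ → φ ∈ X) := by
    refine ⟨(hsA.finite_ne_bot.toFinset ∪ hsB.finite_ne_bot.toFinset).erase χ,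
      fun ψ hψ => (Finset.mem_erase.mp hψ).1, fun φ hφ hne => ?_, fun φ hφ hne => ?_⟩
    · exact Finset.mem_erase.mpr ⟨hne, Finset.mem_union_left _ (hsA.finite_ne_bot.mem_toFinset.mpr hφ)⟩
    · exact Finset.mem_erase.mpr ⟨hne, Finset.mem_union_right _ (hsB.finite_ne_bot.mem_toFinset.mpr hφ)⟩
  -- separating primes
  have hsep : ∀ ψ : X, ∃ q : PrimesNotDvd N, (ψ : PrimesNotDvd N → ℂ) q ≠ χ q := fun ψ =>
    Function.ne_iff.mp (hXne ψ ψ.2)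
  choose qsep hqsep using hsep
  -- the killing product `∏_ψ (T q_ψ - ψ(q_ψ))` and its scalar on `V_φ`
  let L : List (ℕ × ℂ) :=
    X.attach.toList.map fun ψ => ((qsep ψ : ℕ), (ψ : PrimesNotDvd N → ℂ) (qsep ψ))
  have hLprime : ∀ qa ∈ L, qa.1.Prime ∧ ¬ qa.1 ∣ N := by
    intro qa hqa
    obtain ⟨ψ, -, rfl⟩ := List.mem_map.mp hqa
    exact (qsep ψ).2
  let s : (PrimesNotDvd N → ℂ) → ℂ :=
    fun φ => ∏ ψ ∈ X.attach, (φ (qsep ψ) - (ψ : PrimesNotDvd N → ℂ) (qsep ψ))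
  have hscalar : ∀ φ : PrimesNotDvd N → ℂ,
      (L.map fun qa => charExt φ qa.1 - qa.2).prod = s φ := by
    intro φ
    change ((X.attach.toList.map _).map _).prod = ∏ ψ ∈ X.attach, _
    rw [List.map_map, Finset.prod_map_toList]
    simp only [Function.comp_apply, charExt_apply]
  have hsX : ∀ φ ∈ X, s φ = 0 := fun φ hφ =>
    Finset.prod_eq_zero (Finset.mem_attach X ⟨φ, hφ⟩) (sub_self _)
  have hsχ : s χ ≠ 0 := Finset.prod_ne_zero_iff.mpr fun ψ _ =>
    sub_ne_zero.mpr (hqsep ψ).symm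
  -- traces of the product on `A` and on `B`
  have h := trace_listProd_eq_of_trace_eq hA hB htr hLprime
  rw [hsA.trace_listProd_eq_finrank_mul χ hLprime s hscalar (fun φ hφ hne => hsX φ (hXA φ hφ hne)),
    hsB.trace_listProd_eq_finrank_mul χ hLprime s hscalar (fun φ hφ hne => hsX φ (hXB φ hφ hne))] at h
  exact_mod_cast mul_right_cancel₀ hsχ h

omit [FiniteDimensional ℂ A] [FiniteDimensional ℂ B] in
/-- **Equal multiplicities ⇒ isomorphic Hecke modules**: if every eigenvalue system has the same
multiplicity in `A` and `B` (two semisimple commuting families away from `N` on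
finite-dimensional spaces), there is a `ℂ`-linear isomorphism `A ≃ B` intertwining `T_A q` and
`T_B q` for every prime `q ∤ N` (match bases of the simultaneous eigenspaces).
[cite: Pizer1980, Thm. 2.28 (proof)] -/
theorem nonempty_linearEquiv_of_finrank_eigenChar_eq [FiniteDimensional ℂ A] [FiniteDimensional ℂ B]
    (hsA : IsSemisimpleFamily N TA) (hsB : IsSemisimpleFamily N TB)
    (hdim : ∀ χ : PrimesNotDvd N → ℂ,
      Module.finrank ℂ (eigenChar N TA χ) = Module.finrank ℂ (eigenChar N TB χ)) :
    ∃ e : A ≃ₗ[ℂ] B, ∀ (q : PrimesNotDvd N) (a : A), e (TA q a) = TB q (e a) := by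
  classical
  have hintA := hsA.isInternal_eigenChar
  have hintB := hsB.isInternal_eigenChar
  let d : (PrimesNotDvd N → ℂ) → ℕ := fun χ => Module.finrank ℂ (eigenChar N TA χ)
  let bA : ∀ χ, Module.Basis (Fin (d χ)) ℂ (eigenChar N TA χ) := fun χ =>
    Module.finBasisOfFinrankEq ℂ _ rfl
  let bB : ∀ χ, Module.Basis (Fin (d χ)) ℂ (eigenChar N TB χ) := fun χ =>
    Module.finBasisOfFinrankEq ℂ _ (hdim χ).symm
  let cA := hintA.collectedBasis bA
  let cB := hintB.collectedBasis bB
  let e : A ≃ₗ[ℂ] B := cA.equiv cB (Equiv.refl _)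
  refine ⟨e, fun q => ?_⟩
  have key : e.toLinearMap ∘ₗ TA q = TB q ∘ₗ e.toLinearMap := by
    refine cA.ext fun i => ?_
    obtain ⟨χ, j⟩ := i
    have hmemA : cA ⟨χ, j⟩ ∈ eigenChar N TA χ := hintA.collectedBasis_mem bA ⟨χ, j⟩
    have hmemB : cB ⟨χ, j⟩ ∈ eigenChar N TB χ := hintB.collectedBasis_mem bB ⟨χ, j⟩
    have he : e (cA ⟨χ, j⟩) = cB ⟨χ, j⟩ := by
      change cA.equiv cB (Equiv.refl _) (cA ⟨χ, j⟩) = _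
      rw [Module.Basis.equiv_apply]
      rfl
    rw [LinearMap.comp_apply, LinearMap.comp_apply, LinearEquiv.coe_coe,
      mem_eigenChar_iff.mp hmemA q, map_smul, he, mem_eigenChar_iff.mp hmemB q]
  intro a
  have := LinearMap.congr_fun key a
  simpa using this

end Multiplicity



end Literature.NumberTheory.Automorphic

end
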